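import Summits.QuantumFields.BalabanUV.Beta.ChartConjugationDefectEnd
import Summits.QuantumFields.BalabanUV.Beta.BubbleParity

/-!
# `BalabanUV.Beta.ChartConjugationDefectParity` — sign-parity of the chart-conjugation defect in the PACKED fibre: the sandwich defect is
# parity-ODD, its trace against the OFF-DIAGONAL (vh) part of a plain-antisymmetric vertex VANISHES, and the trace defect vanishes on
# diagonal letters for a GRADED-symmetric pair (β sub-cell, row D1 OWNER b2b-balaban-beta-an2, gen 26; K4d of R-D1-g25-5, an3-g48 (τ0) ∕
# an3-g49 [AN3-G49-PARITY] (P2)(P3)(P5), 24 exact-ℚ instances ALL OK)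

HONEST FRAMING (cell charter, verbatim): «discharging BetaPertH makes Balaban's UV stability UNCONDITIONAL — a real
constructive-QFT result; it is NOT the continuum limit and NOT the Clay problem.»  DERIVED cell leaf; [folklore] kernel algebra of OUR objects
(`sgnK` of `BorderedHessianSymmetry`, the parity algebra of `BubbleParity`, `sandwichDefect` of `ChartConjugationDefectEnd`); no statement of Bałaban's papers, no `[cite:]`, no `Prop`
fact, no `def`; instantiates no wall binder.  NOT D1, NOT `BetaPertH`; NOT continuum; NOT Clay.
HONEST DEPENDENCY: continuum YM on T⁴ ⇐ BetaPertH ∧ nine spine estimates (0/9 proved); BetaPertH ⇐ (D1) ∧ (D4) ∧ CAP+tail;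
G-an2-4 gates asym, D1 and NE2/3/4.

WHY.  In the packed KKT fibre the resolvents and bordered Hessians are GRADED-symmetric (`trK K = sgnK K`: `BorderedHessianSymmetry.trK_bhK`,
`trK_KInv`), the slice projector `symEc` and the contact generators `diagK (ctGen …)` are `trK`- and `sgnK`-fixed, and the first-order stencils are
PLAIN-antisymmetric (`SpineRooted.S0At_antisymm`) with an off-diagonal (vh, `sgnK = −`) and a block-diagonal (Wilson∕Λ, `sgnK = +`) part.  Then:
* §1 **`trK_sandwichDefect_eq_neg_sgnK`**: `trK S_X = −sgnK S_X` (the sandwich defect is PARITY-ODD) from `trK A = sgnK A`, `trK 𝕄 = sgnK 𝕄`,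
  `trK X = X = sgnK X`;
* §2 **`tr_comp_sandwichDefect_eq_zero_of_sgnOdd`**: `tr(S_X ∘ V) = 0` for a localised plain-antisymmetric `V` with `sgnK V = −V` — the vh part of
  the first-order letters carries NONE of the chart-conjugation defect `conjDefect` (only the block-diagonal Wilson-ff + Λ parts pair with `S_X`);
* §3 **`traceDefect_eq_zero_of_sgn`**: `tr(Y ∘ conjV 𝕄 A) = 0` for localised `Y` with `trK Y = Y = sgnK Y` and a graded-symmetric pair — the
  packed form of `ChartConjugationDefectEnd.traceDefect_eq_zero_of_symm` (an3 (τ0)/(P5)): the `X′X`- and `X₂`-terms of `conjDefect` drop.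
Provenance: b2b-balaban β sub-cell, unit beta-an2 gen 26, 2026-08-21.
-/

open Finset
open scoped BigOperators
open Literature.MathematicalPhysics.QuantumFieldTheory
open Literature.MathematicalPhysics.QuantumFieldTheory.Balaban1983to89
open Literature.MathematicalPhysics.QuantumFieldTheory.Balaban1983to89.Beta
open ExpKernelCalculus (MKer Decays BiLoc comp tr)
open OneStepResolventKernel (Fib)
open Summit.QuantumFields.BalabanUV.Beta.TameKernelCalculus
open Summit.QuantumFields.BalabanUV.Beta.ChartConjugation (conjV loc_conjV)
open Summit.QuantumFields.BalabanUV.Beta.ChartConjugationRelative (spr_comp)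
open Summit.QuantumFields.BalabanUV.Beta.ChartConjugationDefectEnd (sandwichDefect loc_sandwichDefect')
open Summit.QuantumFields.BalabanUV.Beta.BorderedHessian (sgnF sgnF_mul_self sgnK sgnK_apply sgnK_sgnK comp_sgnK trK_sgnK)
open Summit.QuantumFields.BalabanUV.Beta.BubbleParity (sgnK_neg tr_neg tr_sgnK)

namespace Summit.QuantumFields.BalabanUV.Beta.ChartConjugationDefectParity

noncomputable section

variable {d : ℕ}

/-! ## §0 Sign-conjugation bookkeeping -/

/-- [folklore] Transposition of a commutator of a graded-symmetric `𝕄` with a `trK`∕`sgnK`-fixed `X`: `trK (conjV 𝕄 X) = −sgnK (conjV 𝕄 X)`. -/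
theorem trK_conjV_of_sgn {M X : MKer (d + 1) (Fib d)} (hM : trK M = sgnK M) (hXt : trK X = X) (hXs : sgnK X = X) :
    trK (conjV M X) = -sgnK (conjV M X) := by
  have hsub : ∀ P Q : MKer (d + 1) (Fib d), sgnK (P - Q) = sgnK P - sgnK Q := fun P Q => by
    funext x y a b
    simp only [sgnK_apply, Pi.sub_apply, mul_sub]
  unfold conjV
  rw [trK_sub, trK_comp, trK_comp, hM, hXt, hsub]
  conv_lhs => rw [← hXs]
  rw [comp_sgnK, comp_sgnK]
  abel

/-! ## §1 The sandwich defect is parity-odd -/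

/-- **THE SANDWICH DEFECT IS PARITY-ODD**: for spread `A`, `𝕄` with `trK A = sgnK A`, `trK 𝕄 = sgnK 𝕄` and a localised `X` with
`trK X = X = sgnK X`: `trK (sandwichDefect A 𝕄 X) = −sgnK (sandwichDefect A 𝕄 X)` (an3-g49 (P2)). -/
theorem trK_sandwichDefect_eq_neg_sgnK {A M X : MKer (d + 1) (Fib d)} (hA : Spr A) (hM : Spr M) (hX : Loc X)
    (hAt : trK A = sgnK A) (hMt : trK M = sgnK M) (hXt : trK X = X) (hXs : sgnK X = X) :
    trK (sandwichDefect A M X) = -sgnK (sandwichDefect A M X) := by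
  have hc : Loc (conjV M X) := loc_conjV hM hX
  have h1 : trK (comp (comp A (conjV M X)) A) = -sgnK (comp (comp A (conjV M X)) A) :=
    calc trK (comp (comp A (conjV M X)) A) = comp (trK A) (comp (trK (conjV M X)) (trK A)) := by rw [trK_comp, trK_comp]
      _ = comp (sgnK A) (comp (-sgnK (conjV M X)) (sgnK A)) := by rw [hAt, trK_conjV_of_sgn hMt hXt hXs]
      _ = -(comp (sgnK A) (comp (sgnK (conjV M X)) (sgnK A))) := by rw [comp_neg_left, comp_neg_right]
      _ = -sgnK (comp A (comp (conjV M X) A)) := by rw [comp_sgnK, comp_sgnK]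
      _ = -sgnK (comp (comp A (conjV M X)) A) := by rw [comp_assoc_tame hA.tame hc.tame hA.tame]
  have h2 : trK (conjV A X) = -sgnK (conjV A X) := trK_conjV_of_sgn hAt hXt hXs
  have hadd : ∀ P Q : MKer (d + 1) (Fib d), sgnK (P + Q) = sgnK P + sgnK Q := fun P Q => by
    funext x y a b
    simp only [sgnK_apply, Pi.add_apply, mul_add]
  unfold sandwichDefect
  rw [trK_add, h1, h2, hadd]
  abel

/-! ## §2 The vh part of a plain-antisymmetric vertex sees none of the sandwich defect -/

/-- **`tr(S_X ∘ V) = 0` FOR THE OFF-DIAGONAL PART OF A PLAIN-ANTISYMMETRIC VERTEX** (an3-g49 (P3)): with the hypotheses of §1 and a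
localised `V` with `trK V = −V` (plain antisymmetry) and `sgnK V = −V` (supported on the field–multiplier blocks),
`tr (sandwichDefect A 𝕄 X ∘ V) = 0` — `tr(S V) = tr((S V)ᵀ) = tr(Vᵀ Sᵀ) = tr((−V)(−sgnK S)) = tr(sgnK V · sgnK S)·(−1)… = −tr(S V)`. -/
theorem tr_comp_sandwichDefect_eq_zero_of_sgnOdd {A M X V : MKer (d + 1) (Fib d)} (hA : Spr A) (hM : Spr M) (hX : Loc X)
    (hAt : trK A = sgnK A) (hMt : trK M = sgnK M) (hXt : trK X = X) (hXs : sgnK X = X)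
    (hV : Loc V) (hVt : trK V = -V) (hVs : sgnK V = -V) : tr (comp (sandwichDefect A M X) V) = 0 := by
  have hS : Loc (sandwichDefect A M X) := loc_sandwichDefect' hA hM hX
  have hSt := trK_sandwichDefect_eq_neg_sgnK hA hM hX hAt hMt hXt hXs
  have hV' : V = -sgnK V := by rw [hVs, neg_neg]
  have h : tr (comp (sandwichDefect A M X) V) = -tr (comp (sandwichDefect A M X) V) :=
    calc tr (comp (sandwichDefect A M X) V) = tr (trK (comp (sandwichDefect A M X) V)) := (tr_trK _).symm
      _ = tr (comp (trK V) (trK (sandwichDefect A M X))) := by rw [trK_comp]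
      _ = tr (comp (-V) (-sgnK (sandwichDefect A M X))) := by rw [hVt, hSt]
      _ = tr (comp V (sgnK (sandwichDefect A M X))) := by rw [comp_neg_left, comp_neg_right, neg_neg]
      _ = tr (comp (-sgnK V) (sgnK (sandwichDefect A M X))) := by rw [← hV']
      _ = -tr (sgnK (comp V (sandwichDefect A M X))) := by rw [comp_neg_left, tr_neg, comp_sgnK]
      _ = -tr (comp V (sandwichDefect A M X)) := by rw [tr_sgnK]
      _ = -tr (comp (sandwichDefect A M X) V) := by rw [tr_comp_comm_loc hV hS.tame]
  linarith

/-! ## §3 The trace defect vanishes on diagonal letters for a graded-symmetric pair -/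

/-- **GRADED (τ0)** (an3-g49 (P5)): for spread `A`, `𝕄` with `trK A = sgnK A`, `trK 𝕄 = sgnK 𝕄` and a localised `Y` with `trK Y = Y = sgnK Y`,
`tr (Y ∘ conjV 𝕄 A) = 0` — `tr(Y·𝕄A) = tr((Y·𝕄A)ᵀ) = tr(sgnK(A𝕄)·sgnK Y) = tr(A𝕄·Y) = tr(Y·A𝕄)`. -/
theorem traceDefect_eq_zero_of_sgn {A M Y : MKer (d + 1) (Fib d)} (hA : Spr A) (hM : Spr M) (hY : Loc Y)
    (hAt : trK A = sgnK A) (hMt : trK M = sgnK M) (hYt : trK Y = Y) (hYs : sgnK Y = Y) : tr (comp Y (conjV M A)) = 0 := by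
  have hAM : Tame (comp A M) := (spr_comp hA hM).tame
  have hMA : Tame (comp M A) := (spr_comp hM hA).tame
  have h0 : comp Y (conjV M A) = comp Y (comp M A) - comp Y (comp A M) := by
    unfold conjV
    rw [comp_sub_right_tame hY.tame hMA hAM]
  have h1 : tr (comp Y (comp M A)) = tr (comp Y (comp A M)) :=
    calc tr (comp Y (comp M A)) = tr (trK (comp Y (comp M A))) := (tr_trK _).symm
      _ = tr (comp (comp (trK A) (trK M)) (trK Y)) := by rw [trK_comp, trK_comp]
      _ = tr (comp (comp (sgnK A) (sgnK M)) (sgnK Y)) := by rw [hAt, hMt, hYt, hYs]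
      _ = tr (sgnK (comp (comp A M) Y)) := by rw [comp_sgnK, comp_sgnK]
      _ = tr (comp (comp A M) Y) := tr_sgnK _
      _ = tr (comp Y (comp A M)) := (tr_comp_comm_loc hY hAM).symm
  rw [h0, tr_sub_loc (hY.comp_spr (spr_comp hM hA)) (hY.comp_spr (spr_comp hA hM)), h1, sub_self]

end

end Summit.QuantumFields.BalabanUV.Beta.ChartConjugationDefectParity
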